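import Mathlib
import HarnessLib
import Summits.Ventures.LatticeQCDFlow.Exactness.CosetDomination
import Summits.Ventures.LatticeQCDFlow.Exactness.CabibboMarinariKernel
import Summits.Ventures.LatticeQCDFlow.Exactness.SphereSpreading

/-!
# The Haar probability of a coordinate subgroup of `SU(N)` as a law on `SU(N)`; list convolutions

HONEST FRAMING: exact (Metropolis-corrected) sampling algorithms for lattice gauge theory;
figures of merit are autocorrelation/cost numbers at stated couplings and volumes; no
continuum-physics claim.

Venture `LatticeQCDFlow` (cell pub-lqcd), topic `Exactness`, FANOUT row 9 (eng-latcore, the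
engine `latflow.core`; `update_link` in `csrc/latcore_template.c` runs one Cabibbo–Marinari
heat-bath hit per coordinate pair `(i, j)`, `i < j`, lexicographically).  NEW WORK of the cell
over Mathlib and row 9's earlier files; nothing is cited as a fact.  Printed counterparts, NAMED
ONLY: Diaconis–Shahshahani 1987 (subgroup algorithm); Meyn–Tweedie 1993 Thm 16.0.2 (Doeblin ⇒
uniform ergodicity); Cabibbo–Marinari 1982 (the update).  Part of the proof that the SU(N ≥ 3)
Cabibbo–Marinari heat bath is uniformly ergodic.

## What is proved (`n` a finite nonempty index type; `SU(N) = Matrix.specialUnitaryGroup n ℂ`)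

* §1 `listConv l` (law of the ordered product of independent draws; `listConv_append`);
  **`mconv_compl_eq_zero` / `listConv_compl_eq_zero`** (laws carried by a subgroup stay carried
  under convolution); `mconv_apply_right`.
* §2 **`subHaar s`** — the Haar probability of `coordSubgroup s` pushed into `SU(N)`: probability,
  carried by the subgroup (`subHaar_compl`, `ae_subHaar_mem`), left/right invariant under it
  (`subHaar_map_mul_left/_right`), **`subHaar_mconv_subHaar`** (`subHaar s ∗ subHaar t = subHaar s`
  for `t ⊆ s`), **`subHaar_univ`** (= Haar probability of `SU(N)`, uniqueness of Haar measure),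
  `eq_one_of_mem_coordSubgroup_singleton` (`SU(1) = 1`), `subHaar_singleton = δ₁`,
  **`subHaar_map_orbMap`** (its orbit law is `subLaw s`, `|s| ≥ 2`).

NOT CLAIMED: Haar measures of non-coordinate subgroups; anything quantitative.
-/

namespace Summit.Ventures.LatticeQCDFlow.Exactness

open Matrix MeasureTheory WithLp Metric Complex ProbabilityTheory Measure Set
open scoped ENNReal

variable {n : Type*} [Fintype n] [DecidableEq n]

/-! ## §1 Convolution of a list of laws; laws carried by a subgroup -/

section ListConv

variable {G : Type*} [Group G] [MeasurableSpace G] [MeasurableMul₂ G]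

/-- The convolution of a list of laws: the law of the ordered product of independent draws
(`dirac 1` for the empty list). -/
noncomputable def listConv : List (Measure G) → Measure G
  | [] => Measure.dirac 1
  | μ :: l => μ ∗ₘ listConv l

omit [MeasurableMul₂ G] in
/-- The empty product is `δ₁`. -/
@[simp] theorem listConv_nil : listConv ([] : List (Measure G)) = Measure.dirac 1 := rfl

omit [MeasurableMul₂ G] in
/-- Unfolding one factor. -/
@[simp] theorem listConv_cons (μ : Measure G) (l : List (Measure G)) : listConv (μ :: l) = μ ∗ₘ listConv l := rfl

/-- A convolution of probability laws is a probability law. -/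
theorem isProbabilityMeasure_listConv :
    ∀ (l : List (Measure G)), (∀ μ ∈ l, IsProbabilityMeasure μ) → IsProbabilityMeasure (listConv l)
  | [], _ => by rw [listConv_nil]; infer_instance
  | μ :: l, h => by
      haveI := h μ (by simp)
      haveI := isProbabilityMeasure_listConv l fun ν hν => h ν (by simp [hν])
      rw [listConv_cons]; infer_instance

/-- Concatenation of lists is convolution (associativity). -/
theorem listConv_append :
    ∀ (l₁ l₂ : List (Measure G)), (∀ μ ∈ l₁, IsProbabilityMeasure μ) → (∀ μ ∈ l₂, IsProbabilityMeasure μ) →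
      listConv (l₁ ++ l₂) = listConv l₁ ∗ₘ listConv l₂
  | [], l₂, _, h₂ => by
      haveI := isProbabilityMeasure_listConv l₂ h₂
      rw [List.nil_append, listConv_nil, Measure.dirac_one_mconv]
  | μ :: l₁, l₂, h₁, h₂ => by
      haveI := isProbabilityMeasure_listConv l₂ h₂
      haveI := isProbabilityMeasure_listConv l₁ fun ν hν => h₁ ν (by simp [hν])
      rw [List.cons_append, listConv_cons, listConv_cons,
        listConv_append l₁ l₂ (fun ν hν => h₁ ν (by simp [hν])) h₂, Measure.mconv_assoc]

/-- **Laws carried by a subgroup stay carried under convolution.** -/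
theorem mconv_compl_eq_zero (K : Subgroup G) (hKm : MeasurableSet (K : Set G)) {μ ν : Measure G}
    [SFinite μ] [SFinite ν] (hμ : μ (K : Set G)ᶜ = 0) (hν : ν (K : Set G)ᶜ = 0) :
    (μ ∗ₘ ν) (K : Set G)ᶜ = 0 := by
  rw [mconv_apply μ ν hKm.compl]
  have hae : ∀ᵐ x ∂μ, ν ((fun y => x * y) ⁻¹' (K : Set G)ᶜ) = 0 := by
    filter_upwards [mem_ae_iff.2 hμ] with x hx
    refine measure_mono_null (fun y hy => ?_) hν
    intro hyK
    exact hy (K.mul_mem hx hyK)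
  rw [lintegral_congr_ae hae, lintegral_zero]

/-- A list convolution of laws carried by a subgroup is carried by it. -/
theorem listConv_compl_eq_zero (K : Subgroup G) (hKm : MeasurableSet (K : Set G)) :
    ∀ (l : List (Measure G)), (∀ μ ∈ l, IsProbabilityMeasure μ) → (∀ μ ∈ l, μ (K : Set G)ᶜ = 0) →
      listConv l (K : Set G)ᶜ = 0
  | [], _, _ => by
      rw [listConv_nil, Measure.dirac_apply' _ hKm.compl, Set.indicator_of_notMem]
      exact fun h => h K.one_mem
  | μ :: l, hp, hl => by
      haveI := hp μ (by simp)
      haveI := isProbabilityMeasure_listConv l fun ν hν => hp ν (by simp [hν])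
      rw [listConv_cons]
      exact mconv_compl_eq_zero K hKm (hl μ (by simp))
        (listConv_compl_eq_zero K hKm l (fun ν hν => hp ν (by simp [hν])) fun ν hν => hl ν (by simp [hν]))

/-- `(μ ∗ₘ ν)(A) = ∫ μ{x | x y ∈ A} dν(y)` (integrating over the right factor). -/
theorem mconv_apply_right (μ ν : Measure G) [SFinite μ] [SFinite ν] {A : Set G} (hA : MeasurableSet A) :
    (μ ∗ₘ ν) A = ∫⁻ y, μ ((fun x => x * y) ⁻¹' A) ∂ν := by
  rw [← lintegral_indicator_one hA, Measure.lintegral_mconv_eq_lintegral_prod (measurable_one.indicator hA),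
    lintegral_prod_symm (fun z : G × G => A.indicator (1 : G → ℝ≥0∞) (z.1 * z.2))
      (show Measurable (fun z : G × G => A.indicator (1 : G → ℝ≥0∞) (z.1 * z.2)) from
        (measurable_one.indicator hA).comp measurable_mul).aemeasurable]
  refine lintegral_congr fun y => ?_
  rw [← lintegral_indicator_one (measurable_mul_const y hA)]
  rfl

end ListConv

/-! ## §2 The Haar probability of a coordinate subgroup, as a law on `SU(N)` -/

section SubHaar

/-- **The Haar probability of `coordSubgroup s`**, pushed into `SU(N)`. -/
noncomputable def subHaar (s : Finset n) : Measure (Matrix.specialUnitaryGroup n ℂ) :=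
  (Literature.MathematicalPhysics.QuantumFieldTheory.haarProbability (coordSubgroup s)).map Subtype.val

/-- It is a probability measure. -/
instance isProbabilityMeasure_subHaar (s : Finset n) : IsProbabilityMeasure (subHaar s) :=
  Measure.isProbabilityMeasure_map measurable_subtype_coe.aemeasurable

/-- It is carried by the subgroup. -/
theorem subHaar_compl (s : Finset n) : subHaar s (coordSubgroup s : Set (Matrix.specialUnitaryGroup n ℂ))ᶜ = 0 := by
  rw [subHaar, Measure.map_apply measurable_subtype_coe (isClosed_coordSubgroup s).measurableSet.compl]
  convert measure_empty (μ := Literature.MathematicalPhysics.QuantumFieldTheory.haarProbability (coordSubgroup s))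
  ext x
  simp

/-- Almost-sure form. -/
theorem ae_subHaar_mem (s : Finset n) : ∀ᵐ g ∂(subHaar s), g ∈ coordSubgroup s :=
  mem_ae_iff.2 (subHaar_compl s)

/-- Right invariance under the subgroup. -/
theorem subHaar_map_mul_right {s : Finset n} {k : Matrix.specialUnitaryGroup n ℂ} (hk : k ∈ coordSubgroup s) :
    (subHaar s).map (fun g => g * k) = subHaar s := by
  rw [subHaar, Measure.map_map (measurable_mul_const k) measurable_subtype_coe]
  have h : (fun g : Matrix.specialUnitaryGroup n ℂ => g * k) ∘ (Subtype.val : coordSubgroup s → _) =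
      Subtype.val ∘ (fun x : coordSubgroup s => x * ⟨k, hk⟩) := by
    funext x; rfl
  rw [h, ← Measure.map_map measurable_subtype_coe (measurable_mul_const _), map_mul_right_eq_self]

/-- Left invariance under the subgroup. -/
theorem subHaar_map_mul_left {s : Finset n} {k : Matrix.specialUnitaryGroup n ℂ} (hk : k ∈ coordSubgroup s) :
    (subHaar s).map (fun g => k * g) = subHaar s := by
  rw [subHaar, Measure.map_map (measurable_const_mul k) measurable_subtype_coe]
  have h : (fun g : Matrix.specialUnitaryGroup n ℂ => k * g) ∘ (Subtype.val : coordSubgroup s → _) =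
      Subtype.val ∘ (fun x : coordSubgroup s => (⟨k, hk⟩ : coordSubgroup s) * x) := by
    funext x; rfl
  rw [h, ← Measure.map_map measurable_subtype_coe (measurable_const_mul _), map_mul_left_eq_self]

/-- **Absorption**: `subHaar s ∗ subHaar t = subHaar s` for `t ⊆ s`. -/
theorem subHaar_mconv_subHaar {s t : Finset n} (hts : t ⊆ s) : subHaar s ∗ₘ subHaar t = subHaar s := by
  ext A hA
  rw [mconv_apply_right _ _ hA]
  have hae : ∀ᵐ y ∂(subHaar t), subHaar s ((fun x => x * y) ⁻¹' A) = subHaar s A := by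
    filter_upwards [ae_subHaar_mem t] with y hy
    rw [← Measure.map_apply (measurable_mul_const y) hA, subHaar_map_mul_right (coordSubgroup_mono hts hy)]
  rw [lintegral_congr_ae hae, lintegral_const, measure_univ, mul_one]

/-- **On all coordinates it is the Haar probability of `SU(N)`** (uniqueness of Haar measure). -/
theorem subHaar_univ : subHaar (Finset.univ : Finset n) =
    Literature.MathematicalPhysics.QuantumFieldTheory.haarProbability (Matrix.specialUnitaryGroup n ℂ) := by
  haveI : (subHaar (Finset.univ : Finset n)).IsMulLeftInvariant :=
    ⟨fun g => subHaar_map_mul_left (by rw [coordSubgroup_univ]; trivial)⟩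
  have h := Measure.haarMeasure_unique (subHaar (Finset.univ : Finset n)) ⊤
  have h1 : subHaar (Finset.univ : Finset n) ((⊤ : TopologicalSpace.PositiveCompacts
      (Matrix.specialUnitaryGroup n ℂ)) : Set (Matrix.specialUnitaryGroup n ℂ)) = 1 := by
    rw [TopologicalSpace.PositiveCompacts.coe_top]; exact measure_univ
  rw [h, h1, one_smul]
  rfl

/-- **`coordSubgroup {a}` is trivial** (`SU(1) = 1`: a unitary matrix which is the identity off the
`(a, a)` entry is diagonal with determinant its `(a, a)` entry). -/
theorem eq_one_of_mem_coordSubgroup_singleton {a : n} {g : Matrix.specialUnitaryGroup n ℂ}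
    (hg : g ∈ coordSubgroup ({a} : Finset n)) : g = 1 := by
  have hoff : ∀ b, b ≠ a → b ∉ ({a} : Finset n) := fun b hb => by simp [hb]
  -- `g` is the diagonal matrix `diag(1, …, g a a, …, 1)`
  set d : n → ℂ := fun b => if b = a then (g : Matrix n n ℂ) a a else 1 with hd
  have hdiag : (g : Matrix n n ℂ) = Matrix.diagonal d := by
    ext b c
    rw [Matrix.diagonal_apply]
    by_cases hca : c = a
    · subst hca
      by_cases hba : b = c
      · subst hba; simp [hd]
      · rw [(hg b (hoff b hba) c).2, if_neg hba, if_neg hba]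
    · rw [(hg c (hoff c hca) b).1]
      by_cases hbc : b = c
      · subst hbc; simp [hd, hca]
      · rw [if_neg hbc, if_neg hbc]
  have hdet : (g : Matrix n n ℂ).det = (g : Matrix n n ℂ) a a := by
    rw [hdiag, Matrix.det_diagonal, hd]
    rw [Finset.prod_ite_eq']
    simp
  have haa : (g : Matrix n n ℂ) a a = 1 := by
    rw [← hdet]; exact (Matrix.mem_specialUnitaryGroup_iff.1 g.2).2
  apply Subtype.ext
  rw [hdiag, OneMemClass.coe_one]
  have hd1 : d = fun _ => 1 := by
    funext b; by_cases hb : b = a <;> simp [hd, hb, haa]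
  rw [hd1]
  exact Matrix.diagonal_one

/-- Hence `subHaar {a} = δ₁`. -/
theorem subHaar_singleton (a : n) : subHaar ({a} : Finset n) = Measure.dirac 1 := by
  ext A hA
  have hK : (coordSubgroup ({a} : Finset n) : Set (Matrix.specialUnitaryGroup n ℂ)) = {1} := by
    ext g
    simp only [SetLike.mem_coe, Set.mem_singleton_iff]
    exact ⟨eq_one_of_mem_coordSubgroup_singleton, fun h => h ▸ (coordSubgroup _).one_mem⟩
  have h0 : subHaar ({a} : Finset n) {1}ᶜ = 0 := by rw [← hK]; exact subHaar_compl _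
  rw [Measure.dirac_apply' _ hA, ← measure_inter_conull h0]
  by_cases h1 : (1 : Matrix.specialUnitaryGroup n ℂ) ∈ A
  · rw [Set.indicator_of_mem h1, Pi.one_apply, Set.inter_eq_right.2 (Set.singleton_subset_iff.2 h1)]
    have h := measure_inter_conull (s := Set.univ) h0
    rw [Set.univ_inter, measure_univ] at h
    exact h
  · rw [Set.indicator_of_notMem h1, Set.inter_singleton_eq_empty.2 h1, measure_empty]

variable [Nonempty n]

/-- **The orbit law of `subHaar s` is the sub-sphere law** (`|s| ≥ 2`, `i ∈ s`). -/
theorem subHaar_map_orbMap {s : Finset n} (hs : 2 ≤ s.card) {i : n} (hi : i ∈ s) :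
    (subHaar s).map (orbMap i) = subLaw s := by
  have hsne : s.Nonempty := Finset.card_pos.1 (by omega)
  refine map_orbMap_eq_subLaw hsne (subHaar s) (ae_subHaar_mem s) fun z hz => ?_
  obtain ⟨t, ht, htz⟩ := exists_mem_coordSubgroup_orbMap_eq hs hi z hz
  exact ⟨t, htz, subHaar_map_mul_right ht⟩

end SubHaar

end Summit.Ventures.LatticeQCDFlow.Exactness
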